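import Summits.QuantumFields.BalabanUV.Beta.NVertexEvenCarrier
import Summits.QuantumFields.BalabanUV.Beta.GAN24.BiTableParityHalves

/-!
# `BalabanUV.Beta.NVertexEvenCarrierPeriodised` — row D1 ∕ (C1), PART 22: **THE WOUND EVEN N-FAMILY, COPY-SUMMED IN THE SECOND BOND AND PERIODISED, IS an1's
# CARRIER AT ZERO FIRST-ORDER TABLES OVER THE PERIODISED EVEN TABLES** — `dper M (x z ↦ Σ'_n WN♮ μ y ν (y′+M′∘n) x z) = W2SymOfK (AN R j) (Lc^(j+1)) 0 0 T2_Nᵉ^{per,csf}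
# M2_Nᵉ^{per,cs} μ y ν y′` (`M = Lc^(j+1)·M′`): PART 16's parent `CombHId2W2SymSwap.dper_tsum_W2SymOfK_translate` fed PART 21's closed form and the EVEN tables' sockets

WHY.  v5's H-row `hHN₂` reads `perF T (dper T (wound WN♮))` on the field–field block.  PART 21 `NVertexEvenCarrier.WN_evenHalf_eq_W2SymOfK_zero` wrote the even family as
`W2SymOfK (AN R j) N 0 0 T2_Nᵉ M2_Nᵉ` — an1's carrier with ZERO first-order tables —, so the row's (C2) machinery for the wound second-order words applies to it
VERBATIM: the chart sockets are PART 16's (`decays_AN_family`, `shiftK_AN`), the first-order sockets are trivial at `0` (lit `biLoc_zero`; covariance by `rfl`), and the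
second-order sockets pass to the even halves by GAN24 (`BiTableParityHalves.locStencil₂_evenHalf ∕ shiftK_sgnK_trK`, `SecondOrderCarrierParity.locStencilFM_evenHalf`) from
PART 16's `exists_locStencil₂_T2N ∕ T2N_translate ∕ exists_locStencilFM_M2N` and lit `M2Of_translate`.  The result is the letter at which PART 17's parents read the wound
EVEN family on the torus word by word (PART 23) — three words, the response word being `perF M 0`.

WHAT ([folklore] bookkeeping BY NAME; no `def`, no `def … : Prop`, nothing cited, 0 sorry): §1 the even tables' letters `T2N_even_translate`, `exists_locStencil₂_T2N_even`,
`M2N_even_translate`, `exists_locStencilFM_M2N_even`, and `dper_zero`; §2 **`dper_tsum_WN_evenHalf`**, `WN_evenHalf_wound_per_eq` (family form).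
WHAT THIS IS NOT: not the torus reading (PART 23); not the H-side word nor its junction; nothing of Bałaban's asserted, valued or discharged; 0 estimates beyond [folklore]
geometric series inside the cited parents; 0∕4 row-D1 binders (hW, hR, D1Tel, D1Rep); ROOT M‴ p325680 ∕ P5c ∕ D6 untouched; NOT (C1), NOT (T-ID), NOT D1, NEVER «G-an2-4
closed», NOT BetaPertH, NOT continuum, NOT Clay.

HONEST DEPENDENCY (page 1, mandatory): continuum YM on T⁴ ⇐ BetaPertH ∧ nine spine estimates (0/9 proved); BetaPertH ⇐ (D1) ∧ (D4) ∧ CAP+tail;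
G-an2-4 gates asym, D1 and NE2/3/4.  HONEST FRAMING (cell contract, verbatim): «discharging `BetaPertH` makes Bałaban's UV stability UNCONDITIONAL —
a real constructive-QFT result; it is NOT the continuum limit and NOT the Clay problem.»  ABSOLUTE RULE (cell charter, verbatim): «No internally-minted
statement may enter as a cited fact. Every hypothesis is either kernel-proved in this package or a verbatim quotation of a PUBLISHED theorem with page
reference. The manuscript(s) under audit are NOT citable for their own disputed steps — they are the thing under adjudication; programme-internal
(2001/route/tribunal) claims are never citable.»  Row D1 ∕ (C1) OWNER an2 (b2b-balaban-beta-an2) gen 69, 2026-08-27.  No existing file touched.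
-/

noncomputable section

open scoped BigOperators

namespace Summit.QuantumFields.BalabanUV.Beta.NVertexEvenCarrierPeriodised

open Literature.MathematicalPhysics.QuantumFieldTheory
open Literature.MathematicalPhysics.QuantumFieldTheory.Balaban1983to89
open Literature.MathematicalPhysics.QuantumFieldTheory.Balaban1983to89.Beta
open B4TorusKernel.MultiPeriod (translate)
open ExpKernelCalculus (MKer Decays BiLoc VertexFamily shiftK)
open AffineAveraging (Site box)
open OneStepResolventKernel (Fib LocStencil)
open BalabanCompositeJets (LocStencil₂)
open BalabanStepW2 (M2Of M2Of_translate)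
open HessKerRate (biLoc_zero)
open SecondOrderResponse (W2SymOfK LocStencilFM)
open Summit.QuantumFields.BalabanUV.Beta.TameKernelCalculus (trK)
open Summit.QuantumFields.BalabanUV.Beta.BorderedHessian (sgnK)
open Summit.QuantumFields.BalabanUV.Beta.AxialDressingRooted (one_le_of_neZero)
open Summit.QuantumFields.BalabanUV.Beta.SpineRooted (SpureRecOf T2RecOf)
open Summit.QuantumFields.BalabanUV.Beta.CompositeCorrectorDress (compChart)
open Summit.QuantumFields.BalabanUV.Beta.CompositeOneShotJets (tabsComp)
open Summit.QuantumFields.BalabanUV.Beta.CompositeOneShotJetData (Roots Pins AN AN_eq WN)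
open Summit.QuantumFields.BalabanUV.Beta.FP.KernelPeriodisationFibLoc (dper dper_apply)
open Summit.QuantumFields.BalabanUV.Beta.CombHId2W2SymSwap (dper_tsum_W2SymOfK_translate)
open Summit.QuantumFields.BalabanUV.Beta.GAN24.BiTableParityHalves (locStencil₂_evenHalf shiftK_sgnK_trK)
open Summit.QuantumFields.BalabanUV.Beta.GAN24.SecondOrderCarrierParity (locStencilFM_evenHalf)
open Summit.QuantumFields.BalabanUV.Beta.NVertexWoundPeriodised (decays_AN_family shiftK_AN exists_locStencil₂_T2N T2N_translate exists_locStencilFM_M2N)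
open Summit.QuantumFields.BalabanUV.Beta.NVertexEvenCarrier (WN_evenHalf_eq_W2SymOfK_zero)

variable {Lc : ℕ} [NeZero Lc] (R : Roots Lc) (P : Pins) (j : ℕ)

/-! ## §1 The even tables' letters for the sockets of `dper_tsum_W2SymOfK_translate` -/

section Letters

/-- [folklore] (T2ᵉt) the JOINT block covariance of the EVEN half of `T2_N` (PART 16 `T2N_translate` + GAN24 `shiftK_sgnK_trK`; `shiftK` commutes with `•`, `+` by `rfl`). -/
theorem T2N_even_translate (κ : Fin (3 + 1)) (u : Fin (3 + 1) → ℤ) (κ' : Fin (3 + 1)) (u' t : Fin (3 + 1) → ℤ) :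
    ((1 / 2 : ℝ) • (T2RecOf 3 (Lc ^ (j + 1)) (fun _ => compChart R.rc Lc (j + 1) (R.s (j + 1)) (Lc ^ (j + 1)))
        (SpureRecOf 3 (Lc ^ (j + 1)) (tabsComp (j + 1) (one_le_of_neZero Lc) R.hr (P.cM (j + 1))).V
        (tabsComp (j + 1) (one_le_of_neZero Lc) R.hr (P.cM (j + 1))).H (fun _ => compChart R.rc Lc (j + 1) (R.s (j + 1)) (Lc ^ (j + 1)))
        (P.cE (j + 1)) (P.cVH (j + 1)) (P.cΛ (j + 1)))
        (tabsComp (j + 1) (one_le_of_neZero Lc) R.hr (P.cM (j + 1))).M (P.cE₂ (j + 1)) (P.cB (j + 1)) (P.T (j + 1))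
        (tabsComp (j + 1) (one_le_of_neZero Lc) R.hr (P.cM (j + 1))).vh₂S (tabsComp (j + 1) (one_le_of_neZero Lc) R.hr (P.cM (j + 1))).mixFF 0 κ (u + ((Lc ^ (j + 1) : ℕ) : ℤ) • t) κ' (u' + ((Lc ^ (j + 1) : ℕ) : ℤ) • t)
          + sgnK (trK (T2RecOf 3 (Lc ^ (j + 1)) (fun _ => compChart R.rc Lc (j + 1) (R.s (j + 1)) (Lc ^ (j + 1)))
        (SpureRecOf 3 (Lc ^ (j + 1)) (tabsComp (j + 1) (one_le_of_neZero Lc) R.hr (P.cM (j + 1))).V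
        (tabsComp (j + 1) (one_le_of_neZero Lc) R.hr (P.cM (j + 1))).H (fun _ => compChart R.rc Lc (j + 1) (R.s (j + 1)) (Lc ^ (j + 1)))
        (P.cE (j + 1)) (P.cVH (j + 1)) (P.cΛ (j + 1)))
        (tabsComp (j + 1) (one_le_of_neZero Lc) R.hr (P.cM (j + 1))).M (P.cE₂ (j + 1)) (P.cB (j + 1)) (P.T (j + 1))
        (tabsComp (j + 1) (one_le_of_neZero Lc) R.hr (P.cM (j + 1))).vh₂S (tabsComp (j + 1) (one_le_of_neZero Lc) R.hr (P.cM (j + 1))).mixFF 0 κ (u + ((Lc ^ (j + 1) : ℕ) : ℤ) • t) κ' (u' + ((Lc ^ (j + 1) : ℕ) : ℤ) • t)))))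
      = shiftK (-(((Lc ^ (j + 1) : ℕ) : ℤ) • t)) ((1 / 2 : ℝ) • (T2RecOf 3 (Lc ^ (j + 1)) (fun _ => compChart R.rc Lc (j + 1) (R.s (j + 1)) (Lc ^ (j + 1)))
        (SpureRecOf 3 (Lc ^ (j + 1)) (tabsComp (j + 1) (one_le_of_neZero Lc) R.hr (P.cM (j + 1))).V
        (tabsComp (j + 1) (one_le_of_neZero Lc) R.hr (P.cM (j + 1))).H (fun _ => compChart R.rc Lc (j + 1) (R.s (j + 1)) (Lc ^ (j + 1)))
        (P.cE (j + 1)) (P.cVH (j + 1)) (P.cΛ (j + 1)))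
        (tabsComp (j + 1) (one_le_of_neZero Lc) R.hr (P.cM (j + 1))).M (P.cE₂ (j + 1)) (P.cB (j + 1)) (P.T (j + 1))
        (tabsComp (j + 1) (one_le_of_neZero Lc) R.hr (P.cM (j + 1))).vh₂S (tabsComp (j + 1) (one_le_of_neZero Lc) R.hr (P.cM (j + 1))).mixFF 0 κ u κ' u'
          + sgnK (trK (T2RecOf 3 (Lc ^ (j + 1)) (fun _ => compChart R.rc Lc (j + 1) (R.s (j + 1)) (Lc ^ (j + 1)))
        (SpureRecOf 3 (Lc ^ (j + 1)) (tabsComp (j + 1) (one_le_of_neZero Lc) R.hr (P.cM (j + 1))).V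
        (tabsComp (j + 1) (one_le_of_neZero Lc) R.hr (P.cM (j + 1))).H (fun _ => compChart R.rc Lc (j + 1) (R.s (j + 1)) (Lc ^ (j + 1)))
        (P.cE (j + 1)) (P.cVH (j + 1)) (P.cΛ (j + 1)))
        (tabsComp (j + 1) (one_le_of_neZero Lc) R.hr (P.cM (j + 1))).M (P.cE₂ (j + 1)) (P.cB (j + 1)) (P.T (j + 1))
        (tabsComp (j + 1) (one_le_of_neZero Lc) R.hr (P.cM (j + 1))).vh₂S (tabsComp (j + 1) (one_le_of_neZero Lc) R.hr (P.cM (j + 1))).mixFF 0 κ u κ' u')))) := by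
  rw [T2N_translate R P j 0 κ u κ' u' t, ← shiftK_sgnK_trK]
  rfl

/-- [folklore] (L2ᵉ) the EVEN half of `T2_N` is a `LocStencil₂` family (PART 16 `exists_locStencil₂_T2N` + GAN24 `locStencil₂_evenHalf`, same constants). -/
theorem exists_locStencil₂_T2N_even : ∃ C δ : ℝ, 0 < δ ∧ LocStencil₂ (fun κ u κ' u' => ((1 / 2 : ℝ) • (T2RecOf 3 (Lc ^ (j + 1)) (fun _ => compChart R.rc Lc (j + 1) (R.s (j + 1)) (Lc ^ (j + 1)))
        (SpureRecOf 3 (Lc ^ (j + 1)) (tabsComp (j + 1) (one_le_of_neZero Lc) R.hr (P.cM (j + 1))).V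
        (tabsComp (j + 1) (one_le_of_neZero Lc) R.hr (P.cM (j + 1))).H (fun _ => compChart R.rc Lc (j + 1) (R.s (j + 1)) (Lc ^ (j + 1)))
        (P.cE (j + 1)) (P.cVH (j + 1)) (P.cΛ (j + 1)))
        (tabsComp (j + 1) (one_le_of_neZero Lc) R.hr (P.cM (j + 1))).M (P.cE₂ (j + 1)) (P.cB (j + 1)) (P.T (j + 1))
        (tabsComp (j + 1) (one_le_of_neZero Lc) R.hr (P.cM (j + 1))).vh₂S (tabsComp (j + 1) (one_le_of_neZero Lc) R.hr (P.cM (j + 1))).mixFF 0 κ u κ' u'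
          + sgnK (trK (T2RecOf 3 (Lc ^ (j + 1)) (fun _ => compChart R.rc Lc (j + 1) (R.s (j + 1)) (Lc ^ (j + 1)))
        (SpureRecOf 3 (Lc ^ (j + 1)) (tabsComp (j + 1) (one_le_of_neZero Lc) R.hr (P.cM (j + 1))).V
        (tabsComp (j + 1) (one_le_of_neZero Lc) R.hr (P.cM (j + 1))).H (fun _ => compChart R.rc Lc (j + 1) (R.s (j + 1)) (Lc ^ (j + 1)))
        (P.cE (j + 1)) (P.cVH (j + 1)) (P.cΛ (j + 1)))
        (tabsComp (j + 1) (one_le_of_neZero Lc) R.hr (P.cM (j + 1))).M (P.cE₂ (j + 1)) (P.cB (j + 1)) (P.T (j + 1))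
        (tabsComp (j + 1) (one_le_of_neZero Lc) R.hr (P.cM (j + 1))).vh₂S (tabsComp (j + 1) (one_le_of_neZero Lc) R.hr (P.cM (j + 1))).mixFF 0 κ u κ' u'))))) C δ := by
  obtain ⟨C, δ, hδ, h⟩ := exists_locStencil₂_T2N R P j 0
  exact ⟨C, δ, hδ, locStencil₂_evenHalf h⟩

/-- [folklore] (M2ᵉt) the JOINT covariance (fine block shift ∕ coarse shift) of the EVEN half of `M2_N` (lit `M2Of_translate` on the record's (Tmix) + GAN24 `shiftK_sgnK_trK`). -/
theorem M2N_even_translate (κ : Fin (3 + 1)) (u : Fin (3 + 1) → ℤ) (ρ : Fin (3 + 1)) (w t : Fin (3 + 1) → ℤ) :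
    ((1 / 2 : ℝ) • (M2Of 3 (Lc ^ (j + 1)) (tabsComp (j + 1) (one_le_of_neZero Lc) R.hr (P.cM (j + 1))).mixFF 0 κ (u + ((Lc ^ (j + 1) : ℕ) : ℤ) • t) ρ (w + t) + sgnK (trK (M2Of 3 (Lc ^ (j + 1)) (tabsComp (j + 1) (one_le_of_neZero Lc) R.hr (P.cM (j + 1))).mixFF 0 κ (u + ((Lc ^ (j + 1) : ℕ) : ℤ) • t) ρ (w + t)))))
      = shiftK (-(((Lc ^ (j + 1) : ℕ) : ℤ) • t)) ((1 / 2 : ℝ) • (M2Of 3 (Lc ^ (j + 1)) (tabsComp (j + 1) (one_le_of_neZero Lc) R.hr (P.cM (j + 1))).mixFF 0 κ u ρ w + sgnK (trK (M2Of 3 (Lc ^ (j + 1)) (tabsComp (j + 1) (one_le_of_neZero Lc) R.hr (P.cM (j + 1))).mixFF 0 κ u ρ w)))) := by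
  rw [M2Of_translate (Lc := Lc ^ (j + 1)) ((tabsComp (j + 1) (one_le_of_neZero Lc) R.hr (P.cM (j + 1))).hmixt) 0 κ u ρ w t, ← shiftK_sgnK_trK]
  rfl

omit [NeZero Lc] in
/-- [folklore] (Lmix₂ᵉ) the EVEN half of `M2_N` is a `LocStencilFM` family (PART 16 `exists_locStencilFM_M2N` + GAN24 `locStencilFM_evenHalf`). -/
theorem exists_locStencilFM_M2N_even (hLc : 1 ≤ Lc) : ∃ C δ : ℝ, 0 < δ ∧
    LocStencilFM (Lc ^ (j + 1)) (fun κ u ρ w => (1 / 2 : ℝ) • (M2Of 3 (Lc ^ (j + 1)) (tabsComp (j + 1) hLc R.hr (P.cM (j + 1))).mixFF 0 κ u ρ w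
      + sgnK (trK (M2Of 3 (Lc ^ (j + 1)) (tabsComp (j + 1) hLc R.hr (P.cM (j + 1))).mixFF 0 κ u ρ w)))) C δ := by
  obtain ⟨C, δ, hδ, h⟩ := exists_locStencilFM_M2N R P j hLc 0
  exact ⟨C, δ, hδ, locStencilFM_evenHalf h⟩

/-- [folklore] the periodisation of the zero kernel is the zero kernel. -/
theorem dper_zero {d : ℕ} (M : Fin (d + 1) → ℕ) : dper M (0 : MKer (d + 1) (Fib d)) = 0 := by
  funext x z a b
  simp only [dper_apply, Pi.zero_apply, tsum_zero]

end Letters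

/-! ## §2 The wound even N-family, periodised -/

section WSlot

variable (M : Fin (3 + 1) → ℕ) [∀ μ, NeZero (M μ)] {M' : Fin (3 + 1) → ℕ}

/-- [folklore] **`dper_tsum_WN_evenHalf` — THE WOUND EVEN N-FAMILY, COPY-SUMMED IN THE SECOND BOND AND PERIODISED, IS an1's CARRIER AT ZERO FIRST-ORDER TABLES OVER THE
PERIODISED EVEN TABLES** (`M = Lc^(j+1)·M′`):
`dper M (x z a c ↦ Σ'_n WN♮ μ y ν (translate M′ y′ n) x z a c) = W2SymOfK (AN R j) (Lc^(j+1)) 0 0 T2_Nᵉ^{per,csf} M2_Nᵉ^{per,cs} μ y ν y′`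
— PART 21 `WN_evenHalf_eq_W2SymOfK_zero` termwise, then `CombHId2W2SymSwap.dper_tsum_W2SymOfK_translate` with §1's letters and the trivial zero-table sockets. -/
theorem dper_tsum_WN_evenHalf (hM : ∀ i, M i = Lc ^ (j + 1) * M' i) (μ : Fin (3 + 1)) (y : Site (3 + 1)) (ν : Fin (3 + 1)) (y' : Site (3 + 1)) :
    dper M (fun x z a c => ∑' n : Site (3 + 1), ((1 / 2 : ℝ) • (WN R P j μ y ν (translate M' y' n) + sgnK (trK (WN R P j μ y ν (translate M' y' n))))) x z a c)
      = W2SymOfK (AN R j) (Lc ^ (j + 1)) (0 : Fin (3 + 1) → (Fin (3 + 1) → ℤ) → MKer (3 + 1) (Fib 3)) (0 : Fin (3 + 1) → (Fin (3 + 1) → ℤ) → MKer (3 + 1) (Fib 3))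
          (fun κ u κ' u' => dper M (fun x z a c => ∑' n : Site (3 + 1),
            ((1 / 2 : ℝ) • (T2RecOf 3 (Lc ^ (j + 1)) (fun _ => compChart R.rc Lc (j + 1) (R.s (j + 1)) (Lc ^ (j + 1)))
        (SpureRecOf 3 (Lc ^ (j + 1)) (tabsComp (j + 1) (one_le_of_neZero Lc) R.hr (P.cM (j + 1))).V
        (tabsComp (j + 1) (one_le_of_neZero Lc) R.hr (P.cM (j + 1))).H (fun _ => compChart R.rc Lc (j + 1) (R.s (j + 1)) (Lc ^ (j + 1)))
        (P.cE (j + 1)) (P.cVH (j + 1)) (P.cΛ (j + 1)))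
        (tabsComp (j + 1) (one_le_of_neZero Lc) R.hr (P.cM (j + 1))).M (P.cE₂ (j + 1)) (P.cB (j + 1)) (P.T (j + 1))
        (tabsComp (j + 1) (one_le_of_neZero Lc) R.hr (P.cM (j + 1))).vh₂S (tabsComp (j + 1) (one_le_of_neZero Lc) R.hr (P.cM (j + 1))).mixFF 0 κ u κ' (translate M u' n)
          + sgnK (trK (T2RecOf 3 (Lc ^ (j + 1)) (fun _ => compChart R.rc Lc (j + 1) (R.s (j + 1)) (Lc ^ (j + 1)))
        (SpureRecOf 3 (Lc ^ (j + 1)) (tabsComp (j + 1) (one_le_of_neZero Lc) R.hr (P.cM (j + 1))).V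
        (tabsComp (j + 1) (one_le_of_neZero Lc) R.hr (P.cM (j + 1))).H (fun _ => compChart R.rc Lc (j + 1) (R.s (j + 1)) (Lc ^ (j + 1)))
        (P.cE (j + 1)) (P.cVH (j + 1)) (P.cΛ (j + 1)))
        (tabsComp (j + 1) (one_le_of_neZero Lc) R.hr (P.cM (j + 1))).M (P.cE₂ (j + 1)) (P.cB (j + 1)) (P.T (j + 1))
        (tabsComp (j + 1) (one_le_of_neZero Lc) R.hr (P.cM (j + 1))).vh₂S (tabsComp (j + 1) (one_le_of_neZero Lc) R.hr (P.cM (j + 1))).mixFF 0 κ u κ' (translate M u' n))))) x z a c))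
          (fun κ u ρ w => dper M (fun x z a c => ∑' n : Site (3 + 1),
            ((1 / 2 : ℝ) • (M2Of 3 (Lc ^ (j + 1)) (tabsComp (j + 1) (one_le_of_neZero Lc) R.hr (P.cM (j + 1))).mixFF 0 κ u ρ (translate M' w n) + sgnK (trK (M2Of 3 (Lc ^ (j + 1)) (tabsComp (j + 1) (one_le_of_neZero Lc) R.hr (P.cM (j + 1))).mixFF 0 κ u ρ (translate M' w n))))) x z a c)) μ y ν y' := by
  obtain ⟨δG, CG, hδG, hCG, hG⟩ := decays_AN_family R j 0
  obtain ⟨C₂, δ₂, hδ₂, hS₂⟩ := exists_locStencil₂_T2N_even R P j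
  obtain ⟨Cm, δm, hδm, hM₂⟩ := exists_locStencilFM_M2N_even R P j (one_le_of_neZero Lc)
  have e : (fun x z a c => ∑' n : Site (3 + 1), ((1 / 2 : ℝ) • (WN R P j μ y ν (translate M' y' n) + sgnK (trK (WN R P j μ y ν (translate M' y' n))))) x z a c)
      = fun x z a c => ∑' n : Site (3 + 1), W2SymOfK (compChart R.rc Lc (j + 1) (R.s (j + 1)) (Lc ^ (j + 1))) (Lc ^ (j + 1)) (0 : Fin (3 + 1) → (Fin (3 + 1) → ℤ) → MKer (3 + 1) (Fib 3)) (0 : Fin (3 + 1) → (Fin (3 + 1) → ℤ) → MKer (3 + 1) (Fib 3))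
          (fun κ u κ' u' => ((1 / 2 : ℝ) • (T2RecOf 3 (Lc ^ (j + 1)) (fun _ => compChart R.rc Lc (j + 1) (R.s (j + 1)) (Lc ^ (j + 1)))
        (SpureRecOf 3 (Lc ^ (j + 1)) (tabsComp (j + 1) (one_le_of_neZero Lc) R.hr (P.cM (j + 1))).V
        (tabsComp (j + 1) (one_le_of_neZero Lc) R.hr (P.cM (j + 1))).H (fun _ => compChart R.rc Lc (j + 1) (R.s (j + 1)) (Lc ^ (j + 1)))
        (P.cE (j + 1)) (P.cVH (j + 1)) (P.cΛ (j + 1)))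
        (tabsComp (j + 1) (one_le_of_neZero Lc) R.hr (P.cM (j + 1))).M (P.cE₂ (j + 1)) (P.cB (j + 1)) (P.T (j + 1))
        (tabsComp (j + 1) (one_le_of_neZero Lc) R.hr (P.cM (j + 1))).vh₂S (tabsComp (j + 1) (one_le_of_neZero Lc) R.hr (P.cM (j + 1))).mixFF 0 κ u κ' u'
          + sgnK (trK (T2RecOf 3 (Lc ^ (j + 1)) (fun _ => compChart R.rc Lc (j + 1) (R.s (j + 1)) (Lc ^ (j + 1)))
        (SpureRecOf 3 (Lc ^ (j + 1)) (tabsComp (j + 1) (one_le_of_neZero Lc) R.hr (P.cM (j + 1))).V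
        (tabsComp (j + 1) (one_le_of_neZero Lc) R.hr (P.cM (j + 1))).H (fun _ => compChart R.rc Lc (j + 1) (R.s (j + 1)) (Lc ^ (j + 1)))
        (P.cE (j + 1)) (P.cVH (j + 1)) (P.cΛ (j + 1)))
        (tabsComp (j + 1) (one_le_of_neZero Lc) R.hr (P.cM (j + 1))).M (P.cE₂ (j + 1)) (P.cB (j + 1)) (P.T (j + 1))
        (tabsComp (j + 1) (one_le_of_neZero Lc) R.hr (P.cM (j + 1))).vh₂S (tabsComp (j + 1) (one_le_of_neZero Lc) R.hr (P.cM (j + 1))).mixFF 0 κ u κ' u')))))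
          (fun κ u ρ w => ((1 / 2 : ℝ) • (M2Of 3 (Lc ^ (j + 1)) (tabsComp (j + 1) (one_le_of_neZero Lc) R.hr (P.cM (j + 1))).mixFF 0 κ u ρ w + sgnK (trK (M2Of 3 (Lc ^ (j + 1)) (tabsComp (j + 1) (one_le_of_neZero Lc) R.hr (P.cM (j + 1))).mixFF 0 κ u ρ w))))) μ y ν (translate M' y' n) x z a c := by
    funext x z a c
    exact tsum_congr fun n => by rw [WN_evenHalf_eq_W2SymOfK_zero R P j μ y ν (translate M' y' n), AN_eq]
  have h := dper_tsum_W2SymOfK_translate M hM (shiftK_AN R j 0) hG hCG hδG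
    (S := (0 : Fin (3 + 1) → (Fin (3 + 1) → ℤ) → MKer (3 + 1) (Fib 3))) (fun _ _ _ => rfl) (fun κ u => biLoc_zero _ _ (1 : ℝ)) one_pos
    (Mt := (0 : Fin (3 + 1) → (Fin (3 + 1) → ℤ) → MKer (3 + 1) (Fib 3))) (fun _ _ _ => rfl) (fun ρ w => biLoc_zero _ _ (1 : ℝ)) one_pos
    (T2N_even_translate R P j) hS₂ hδ₂ (M2N_even_translate R P j) hM₂ hδm μ y ν y'
  rw [e, h, AN_eq]
  simp only [Pi.zero_apply, dper_zero]
  rfl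

/-- [folklore] **`WN_evenHalf_wound_per_eq`** — the same as an equality of BOND FAMILIES (the letter at which PART 17's parents read the wound even family on the torus). -/
theorem WN_evenHalf_wound_per_eq (hM : ∀ i, M i = Lc ^ (j + 1) * M' i) :
    (fun μ y ν y' => dper M (fun x z a c => ∑' n : Site (3 + 1), ((1 / 2 : ℝ) • (WN R P j μ y ν (translate M' y' n) + sgnK (trK (WN R P j μ y ν (translate M' y' n))))) x z a c))
      = W2SymOfK (AN R j) (Lc ^ (j + 1)) (0 : Fin (3 + 1) → (Fin (3 + 1) → ℤ) → MKer (3 + 1) (Fib 3)) (0 : Fin (3 + 1) → (Fin (3 + 1) → ℤ) → MKer (3 + 1) (Fib 3))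
          (fun κ u κ' u' => dper M (fun x z a c => ∑' n : Site (3 + 1),
            ((1 / 2 : ℝ) • (T2RecOf 3 (Lc ^ (j + 1)) (fun _ => compChart R.rc Lc (j + 1) (R.s (j + 1)) (Lc ^ (j + 1)))
        (SpureRecOf 3 (Lc ^ (j + 1)) (tabsComp (j + 1) (one_le_of_neZero Lc) R.hr (P.cM (j + 1))).V
        (tabsComp (j + 1) (one_le_of_neZero Lc) R.hr (P.cM (j + 1))).H (fun _ => compChart R.rc Lc (j + 1) (R.s (j + 1)) (Lc ^ (j + 1)))
        (P.cE (j + 1)) (P.cVH (j + 1)) (P.cΛ (j + 1)))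
        (tabsComp (j + 1) (one_le_of_neZero Lc) R.hr (P.cM (j + 1))).M (P.cE₂ (j + 1)) (P.cB (j + 1)) (P.T (j + 1))
        (tabsComp (j + 1) (one_le_of_neZero Lc) R.hr (P.cM (j + 1))).vh₂S (tabsComp (j + 1) (one_le_of_neZero Lc) R.hr (P.cM (j + 1))).mixFF 0 κ u κ' (translate M u' n)
          + sgnK (trK (T2RecOf 3 (Lc ^ (j + 1)) (fun _ => compChart R.rc Lc (j + 1) (R.s (j + 1)) (Lc ^ (j + 1)))
        (SpureRecOf 3 (Lc ^ (j + 1)) (tabsComp (j + 1) (one_le_of_neZero Lc) R.hr (P.cM (j + 1))).V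
        (tabsComp (j + 1) (one_le_of_neZero Lc) R.hr (P.cM (j + 1))).H (fun _ => compChart R.rc Lc (j + 1) (R.s (j + 1)) (Lc ^ (j + 1)))
        (P.cE (j + 1)) (P.cVH (j + 1)) (P.cΛ (j + 1)))
        (tabsComp (j + 1) (one_le_of_neZero Lc) R.hr (P.cM (j + 1))).M (P.cE₂ (j + 1)) (P.cB (j + 1)) (P.T (j + 1))
        (tabsComp (j + 1) (one_le_of_neZero Lc) R.hr (P.cM (j + 1))).vh₂S (tabsComp (j + 1) (one_le_of_neZero Lc) R.hr (P.cM (j + 1))).mixFF 0 κ u κ' (translate M u' n))))) x z a c))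
          (fun κ u ρ w => dper M (fun x z a c => ∑' n : Site (3 + 1),
            ((1 / 2 : ℝ) • (M2Of 3 (Lc ^ (j + 1)) (tabsComp (j + 1) (one_le_of_neZero Lc) R.hr (P.cM (j + 1))).mixFF 0 κ u ρ (translate M' w n) + sgnK (trK (M2Of 3 (Lc ^ (j + 1)) (tabsComp (j + 1) (one_le_of_neZero Lc) R.hr (P.cM (j + 1))).mixFF 0 κ u ρ (translate M' w n))))) x z a c)) := by
  funext μ y ν y'
  exact dper_tsum_WN_evenHalf R P j M hM μ y ν y'

end WSlot

end Summit.QuantumFields.BalabanUV.Beta.NVertexEvenCarrierPeriodised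

end
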